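import Summits.QuantumFields.YangMills.Theorems.ColdStartUniversalityLatticeLangevinEntropyFisherLimits
import Summits.QuantumFields.YangMills.Theorems.ColdStartUniversalityLatticeLangevinFisherDissipation
import Summits.QuantumFields.YangMills.Theorems.ColdStartUniversalityLatticeLangevinGeneratorFrameForm
import HarnessLib

/-!
# Route `ColdStartUniversality` (fixed-cut-off package, Bakry–Émery side, log-Sobolev half): EXPONENTIAL DECAY OF THE ENTROPY
# along the SZZ semigroup from the entropic curvature inequality (the Bakry–Émery entropy argument)

Helper file (seat `ym-line-csu-p1`, g26; `--supports stmt-QuantumFields-24809`).  For the SU(2) lattice Langevin dynamics of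
Shen–Zhu–Zhu on `(ℤ/L)³` at a FIXED cut-off and coupling `β'` (`μ = μ_(β')`, `𝓛 = 𝓛_(β')`, `κ_t` any realising kernel family):
* ★ `exists_ambient_generator` — a `C⁵` compactly supported `q` has a `C³` compactly supported ambient representative `G` of `𝓛q`
  (`G∘coords = 𝓛q`; `G = ½Σ_n(W_nW_n q + W_nψ̂·W_n q)` along the noise frame, `generator_eq_half_frameGen`);
* ★★★ `entropy_transition_le_exp_of_entropicCurvature` — IF for some `c₀ > 0` every `C³` `h` satisfies the entropic curvature inequality
  `c₀·(−∫ 𝓛(e^h)·h dμ) ≤ ∫ 𝓛(e^h)·𝓛h dμ + ∫ (𝓛e^h)²/e^h dμ` (`hECD`; = `CD(c₀/2, ∞)` in entropic form, supplied with `c₀ = 2 − K₀` by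
  `…BakryEmeryEntropicCurvature`), THEN for every positive `C⁵` compactly supported cylinder density `Q = q∘coords` and every `t`:
    `Ent_μ(κ_t Q) ≤ e^(−c₀ t) · Ent_μ(Q)`.
Proof (Bakry–Émery 1985; Bakry–Gentil–Ledoux 2014 Prop. 5.7.3 / Thm 5.2.1): with `H(τ) = ∫ κ_τQ log κ_τQ dμ`, `J(τ) = ∫ κ_τ(𝓛q)·log κ_τQ dμ`
`= −I(τ)`: `H' = J` (de Bruijn, `…EntropyFisherCalculus`), `J' ≥ −c₀ J` (`…FisherDissipation`), so `H + J/c₀` is non-decreasing on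
`[0,∞)`; it tends to `m log m` (`…EntropyFisherLimits`), whence `H − m log m ≤ −J/c₀ = −H'/c₀` and Grönwall.
THEOREMS ONLY, no definition, no sorry.  HONEST FRAMING: fixed cut-off, conditional on `hECD`; nothing K-uniform in the route's scaling;
no crux, rung or summit statement is proved; the Yang–Mills mass gap is NOT proved.
-/

set_option autoImplicit false

noncomputable section

namespace Summit.QuantumFields.YangMills.Theorems.ColdStartUniversality

open MeasureTheory ProbabilityTheory Finset Filter Set
open scoped BigOperators NNReal ENNReal Topology
open Literature.Probability.Process Literature.MathematicalPhysics.QuantumFieldTheory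
open Literature.MathematicalPhysics.QuantumLattice (fundamentalRep fundamentalLatticeRep continuous_fundamentalRep)

variable {L : ℕ} [NeZero L]

/-! ## §1. An ambient representative of `𝓛q` -/

/-- ★ **`𝓛q` is a `C³` compactly supported cylinder function when `q ∈ C⁵_c`.**  Along the noise frame `s_n` of `exists_noiseFrame`,
`G = ½ Σ_n (W_nW_n q + W_nψ̂ · W_n q)` is `C³`, compactly supported, and `G∘coords = 𝓛_(β') q` (`generator_eq_half_frameGen`). [folklore] -/
theorem exists_ambient_generator (L : ℕ) [NeZero L] (β' : ℝ) {q : (Edge 3 L × Fin 2 × Fin 2 × Bool → ℝ) → ℝ} (hq : ContDiff ℝ 5 q) (hqc : HasCompactSupport q) :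
    let coords : GaugeConfig 3 L (Matrix.specialUnitaryGroup (Fin 2) ℂ) → (Edge 3 L × Fin 2 × Fin 2 × Bool → ℝ) :=
      fun V q => (fun z : ℂ => if q.2.2.2 then z.im else z.re)
        ((fundamentalRep (Fin 2) (V q.1) : Matrix (Fin 2) (Fin 2) ℂ) q.2.1 q.2.2.1)
    let gen : ((Edge 3 L × Fin 2 × Fin 2 × Bool → ℝ) → ℝ) → GaugeConfig 3 L (Matrix.specialUnitaryGroup (Fin 2) ℂ) → ℝ :=
      fun h V =>
      (∑ i : Edge 3 L × Fin 2 × Fin 2 × Bool, fderiv ℝ h (coords V) (Pi.single i 1) *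
          (fun z : ℂ => if i.2.2.2 then z.im else z.re)
            ((latticeLangevinDynamics (fundamentalLatticeRep 2) β').drift
              (matrixConfig (fundamentalRep (Fin 2)) V) i.1 i.2.1 i.2.2.1) +
      1 / 2 * ∑ i : Edge 3 L × Fin 2 × Fin 2 × Bool, ∑ j : Edge 3 L × Fin 2 × Fin 2 × Bool,
        fderiv ℝ (fun z => fderiv ℝ h z (Pi.single i 1)) (coords V) (Pi.single j 1) *
          ∑ n : Edge 3 L × NoiseIdx 2,
            (if n.1 = i.1 then (fun z : ℂ => if i.2.2.2 then z.im else z.re)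
              ((latticeLangevinDynamics (fundamentalLatticeRep 2) β').noise
                (matrixConfig (fundamentalRep (Fin 2)) V) i.1 n.2 i.2.1 i.2.2.1) else 0) *
            (if n.1 = j.1 then (fun z : ℂ => if j.2.2.2 then z.im else z.re)
              ((latticeLangevinDynamics (fundamentalLatticeRep 2) β').noise
                (matrixConfig (fundamentalRep (Fin 2)) V) j.1 n.2 j.2.1 j.2.2.1) else 0))
    ∃ G : (Edge 3 L × Fin 2 × Fin 2 × Bool → ℝ) → ℝ, ContDiff ℝ 3 G ∧ HasCompactSupport G ∧ ∀ x, G (coords x) = gen q x := by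
  intro coords gen
  classical
  obtain ⟨s, c, hs, hbr, hanti, hRic, hCas⟩ := exists_noiseFrame L
  set s2 : (Edge 3 L × NoiseIdx (fundamentalLatticeRep 2).N) → ((Edge 3 L × Fin 2 × Fin 2 × Bool → ℝ) →L[ℝ] (Edge 3 L × Fin 2 × Fin 2 × Bool → ℝ)) := s with hs2def
  set ψ : (Edge 3 L × Fin 2 × Fin 2 × Bool → ℝ) → ℝ := (fun y : (Edge 3 L × Fin 2 × Fin 2 × Bool → ℝ) => β' * ∑ p : Plaquette 3 L, (rootedLoop (fun (ee : Edge 3 L) (i j : Fin 2) => ((y (ee, i, j, false) : ℝ) : ℂ) + ((y (ee, i, j, true) : ℝ) : ℂ) * Complex.I) (p.1, p.2.1.1) p.2.1.2 false).trace.re) with hψ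
  have hψC : ContDiff ℝ 4 ψ := contDiff_psiHat (d := 3) (L := L) (N := 2) (n := 4) β'
  have hq2 : ContDiff ℝ 2 q := hq.of_le (by norm_num)
  refine ⟨fun z => 1 / 2 * ∑ n, (fderiv ℝ (fun w => fderiv ℝ q w (s2 n w)) z (s2 n z) +
      fderiv ℝ ψ z (s2 n z) * fderiv ℝ q z (s2 n z)), contDiff_const.mul (contDiff_frameGen (k := 3) hq hψC s2), ?_, ?_⟩
  · -- compact support: all frame derivatives of `q` vanish off `tsupport q`
    refine HasCompactSupport.intro (K := tsupport q) hqc.isCompact fun z hz => ?_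
    have hq0 : q =ᶠ[𝓝 z] (fun _ => (0 : ℝ)) := notMem_tsupport_iff_eventuallyEq.1 hz
    have hW0 : ∀ n, (fun w => fderiv ℝ q w (s2 n w)) =ᶠ[𝓝 z] (fun _ => (0 : ℝ)) := by
      intro n
      filter_upwards [hq0.eventually_nhds] with w hw
      have h1 : fderiv ℝ q w = fderiv ℝ (fun _ : (Edge 3 L × Fin 2 × Fin 2 × Bool → ℝ) => (0 : ℝ)) w := Filter.EventuallyEq.fderiv_eq hw
      rw [h1]
      simp
    have hterm : ∀ n, fderiv ℝ (fun w => fderiv ℝ q w (s2 n w)) z (s2 n z) + fderiv ℝ ψ z (s2 n z) * fderiv ℝ q z (s2 n z) = 0 := by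
      intro n
      have h1 : fderiv ℝ (fun w => fderiv ℝ q w (s2 n w)) z = fderiv ℝ (fun _ : (Edge 3 L × Fin 2 × Fin 2 × Bool → ℝ) => (0 : ℝ)) z := (hW0 n).fderiv_eq
      have h2 : fderiv ℝ q z = fderiv ℝ (fun _ : (Edge 3 L × Fin 2 × Fin 2 × Bool → ℝ) => (0 : ℝ)) z := hq0.fderiv_eq
      rw [h1, h2]
      simp
    show 1 / 2 * ∑ n, (fderiv ℝ (fun w => fderiv ℝ q w (s2 n w)) z (s2 n z) + fderiv ℝ ψ z (s2 n z) * fderiv ℝ q z (s2 n z)) = 0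
    rw [Finset.sum_eq_zero fun n _ => hterm n, mul_zero]
  · intro x
    exact (generator_eq_half_frameGen L β' s hs hCas q hq2 x).symm

/-! ## §2. Exponential decay of the entropy -/

/-- ★★★ **Bakry–Émery entropy decay at a fixed cut-off, from the entropic curvature inequality.**  If `c₀ > 0` and every `C³` `h`
satisfies `c₀·(−∫ 𝓛(e^h)·h dμ_(β')) ≤ ∫ 𝓛(e^h)·𝓛h dμ_(β') + ∫ (𝓛e^h)²/e^h dμ_(β')`, then for every realising kernel family, every
positive `C⁵` compactly supported cylinder density `Q = q∘coords` and every `t ≥ 0`,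
`Ent_μ(κ_t Q) ≤ e^(−c₀ t)·Ent_μ(Q)` (`Ent_μ(F) = ∫ F log F dμ − (∫F dμ) log ∫F dμ`). [cite: BakryGentilLedoux2014, Prop. 5.7.3] -/
theorem entropy_transition_le_exp_of_entropicCurvature (L : ℕ) [NeZero L] (β' c₀ : ℝ) (hc₀ : 0 < c₀)
    (hECD : (∀ (h : (Edge 3 L × Fin 2 × Fin 2 × Bool → ℝ) → ℝ), ContDiff ℝ 3 h →
      let coords : GaugeConfig 3 L (Matrix.specialUnitaryGroup (Fin 2) ℂ) → (Edge 3 L × Fin 2 × Fin 2 × Bool → ℝ) :=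
      fun V q => (fun z : ℂ => if q.2.2.2 then z.im else z.re)
        ((fundamentalRep (Fin 2) (V q.1) : Matrix (Fin 2) (Fin 2) ℂ) q.2.1 q.2.2.1)
      let gen : ((Edge 3 L × Fin 2 × Fin 2 × Bool → ℝ) → ℝ) → GaugeConfig 3 L (Matrix.specialUnitaryGroup (Fin 2) ℂ) → ℝ :=
      fun h V =>
      (∑ i : Edge 3 L × Fin 2 × Fin 2 × Bool, fderiv ℝ h (coords V) (Pi.single i 1) *
          (fun z : ℂ => if i.2.2.2 then z.im else z.re)
            ((latticeLangevinDynamics (fundamentalLatticeRep 2) β').drift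
              (matrixConfig (fundamentalRep (Fin 2)) V) i.1 i.2.1 i.2.2.1) +
      1 / 2 * ∑ i : Edge 3 L × Fin 2 × Fin 2 × Bool, ∑ j : Edge 3 L × Fin 2 × Fin 2 × Bool,
        fderiv ℝ (fun z => fderiv ℝ h z (Pi.single i 1)) (coords V) (Pi.single j 1) *
          ∑ n : Edge 3 L × NoiseIdx 2,
            (if n.1 = i.1 then (fun z : ℂ => if i.2.2.2 then z.im else z.re)
              ((latticeLangevinDynamics (fundamentalLatticeRep 2) β').noise
                (matrixConfig (fundamentalRep (Fin 2)) V) i.1 n.2 i.2.1 i.2.2.1) else 0) *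
            (if n.1 = j.1 then (fun z : ℂ => if j.2.2.2 then z.im else z.re)
              ((latticeLangevinDynamics (fundamentalLatticeRep 2) β').noise
                (matrixConfig (fundamentalRep (Fin 2)) V) j.1 n.2 j.2.1 j.2.2.1) else 0))
      c₀ * (-∫ V, gen (fun z => Real.exp (h z)) V * h (coords V) ∂(wilsonMeasure (d := 3) (L := L) (fundamentalRep (Fin 2)) β')) ≤
        ∫ V, gen (fun z => Real.exp (h z)) V * gen h V ∂(wilsonMeasure (d := 3) (L := L) (fundamentalRep (Fin 2)) β') +
          ∫ V, (gen (fun z => Real.exp (h z)) V) ^ 2 / Real.exp (h (coords V)) ∂(wilsonMeasure (d := 3) (L := L) (fundamentalRep (Fin 2)) β')))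
    (κ : ℝ≥0 → Kernel (GaugeConfig 3 L (Matrix.specialUnitaryGroup (Fin 2) ℂ))
      (GaugeConfig 3 L (Matrix.specialUnitaryGroup (Fin 2) ℂ))) [∀ t, IsMarkovKernel (κ t)]
    (hreal : ∀ (t : ℝ≥0) (x : GaugeConfig 3 L (Matrix.specialUnitaryGroup (Fin 2) ℂ))
        (Ω : Type) [MeasurableSpace Ω] (P : Measure Ω) [IsProbabilityMeasure P]
        (W : ℝ≥0 → Ω → (Edge 3 L × NoiseIdx 2 → ℝ)) (hW : IsFlatBrownian W P)
        (U : ℝ≥0 → Ω → GaugeConfig 3 L (Matrix.specialUnitaryGroup (Fin 2) ℂ)),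
        (∀ ω, U 0 ω = x) →
        (latticeLangevinDynamics (fundamentalLatticeRep 2) β').IsSolution (fundamentalRep (Fin 2))
          hW.natFiltration P W U →
        κ t x = P.map (U t))
    {q : (Edge 3 L × Fin 2 × Fin 2 × Bool → ℝ) → ℝ} (hq : ContDiff ℝ 5 q) (hqc : HasCompactSupport q) :
    let coords : GaugeConfig 3 L (Matrix.specialUnitaryGroup (Fin 2) ℂ) → (Edge 3 L × Fin 2 × Fin 2 × Bool → ℝ) :=
      fun V q => (fun z : ℂ => if q.2.2.2 then z.im else z.re)
        ((fundamentalRep (Fin 2) (V q.1) : Matrix (Fin 2) (Fin 2) ℂ) q.2.1 q.2.2.1)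
    (∀ x, 0 < q (coords x)) → ∀ t : ℝ≥0,
    (∫ x, (∫ y, q (coords y) ∂(κ t x)) * Real.log (∫ y, q (coords y) ∂(κ t x)) ∂(wilsonMeasure (d := 3) (L := L) (fundamentalRep (Fin 2)) β')) -
        (∫ x, (∫ y, q (coords y) ∂(κ t x)) ∂(wilsonMeasure (d := 3) (L := L) (fundamentalRep (Fin 2)) β')) * Real.log (∫ x, (∫ y, q (coords y) ∂(κ t x)) ∂(wilsonMeasure (d := 3) (L := L) (fundamentalRep (Fin 2)) β')) ≤
      Real.exp (-c₀ * t) * ((∫ x, q (coords x) * Real.log (q (coords x)) ∂(wilsonMeasure (d := 3) (L := L) (fundamentalRep (Fin 2)) β')) -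
        (∫ x, q (coords x) ∂(wilsonMeasure (d := 3) (L := L) (fundamentalRep (Fin 2)) β')) * Real.log (∫ x, q (coords x) ∂(wilsonMeasure (d := 3) (L := L) (fundamentalRep (Fin 2)) β'))) := by
  intro coords hpos t
  classical
  haveI := secondCountableTopology_su2
  haveI := borelSpace_config L
  set μ : Measure (GaugeConfig 3 L (Matrix.specialUnitaryGroup (Fin 2) ℂ)) := (wilsonMeasure (d := 3) (L := L) (fundamentalRep (Fin 2)) β') with hμ
  haveI : IsProbabilityMeasure μ :=
    isProbabilityMeasure_wilsonMeasure (d := 3) (L := L) (fundamentalRep (Fin 2)) (continuous_fundamentalRep (Fin 2)) β'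
  have hq3 : ContDiff ℝ 3 q := hq.of_le (by norm_num)
  have hco : Continuous coords := continuous_coords (L := L)
  have hQc : Continuous fun V => q (coords V) := hq3.continuous.comp hco
  -- the generator of `q` as a function on the group, and its ambient representative
  let gen : ((Edge 3 L × Fin 2 × Fin 2 × Bool → ℝ) → ℝ) → GaugeConfig 3 L (Matrix.specialUnitaryGroup (Fin 2) ℂ) → ℝ :=
    fun h V =>
    (∑ i : Edge 3 L × Fin 2 × Fin 2 × Bool, fderiv ℝ h (coords V) (Pi.single i 1) *
        (fun z : ℂ => if i.2.2.2 then z.im else z.re)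
          ((latticeLangevinDynamics (fundamentalLatticeRep 2) β').drift
            (matrixConfig (fundamentalRep (Fin 2)) V) i.1 i.2.1 i.2.2.1) +
    1 / 2 * ∑ i : Edge 3 L × Fin 2 × Fin 2 × Bool, ∑ j : Edge 3 L × Fin 2 × Fin 2 × Bool,
      fderiv ℝ (fun z => fderiv ℝ h z (Pi.single i 1)) (coords V) (Pi.single j 1) *
        ∑ n : Edge 3 L × NoiseIdx 2,
          (if n.1 = i.1 then (fun z : ℂ => if i.2.2.2 then z.im else z.re)
            ((latticeLangevinDynamics (fundamentalLatticeRep 2) β').noise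
              (matrixConfig (fundamentalRep (Fin 2)) V) i.1 n.2 i.2.1 i.2.2.1) else 0) *
          (if n.1 = j.1 then (fun z : ℂ => if j.2.2.2 then z.im else z.re)
            ((latticeLangevinDynamics (fundamentalLatticeRep 2) β').noise
              (matrixConfig (fundamentalRep (Fin 2)) V) j.1 n.2 j.2.1 j.2.2.1) else 0))
  obtain ⟨G, hG, hGc, hGq⟩ : ∃ G : (Edge 3 L × Fin 2 × Fin 2 × Bool → ℝ) → ℝ, ContDiff ℝ 3 G ∧ HasCompactSupport G ∧ ∀ x, G (coords x) = gen q x :=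
    exists_ambient_generator L β' hq hqc
  -- standing facts
  obtain ⟨M, hMq, -, hgenc, hPFb, hPGb, hPFcx, hPGcx, hPFct, hPGct, hPFder, hinv, hinvG⟩ :=
    transition_cylinder_toolkit L β' κ hreal hq3 hqc
  obtain ⟨M', -, -, -, -, hPHb, -, hPHcx, -, -, -, -, -⟩ := transition_cylinder_toolkit L β' κ hreal hG hGc
  obtain ⟨δ, hδ, hQδ⟩ : ∃ δ : ℝ, 0 < δ ∧ ∀ x : (GaugeConfig 3 L (Matrix.specialUnitaryGroup (Fin 2) ℂ)), δ ≤ q (coords x) := by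
    obtain ⟨x₀, -, hx₀⟩ := isCompact_univ.exists_isMinOn (Set.univ_nonempty) hQc.continuousOn
    exact ⟨q (coords x₀), hpos x₀, fun x => hx₀ (Set.mem_univ x)⟩
  obtain ⟨PF, hPF⟩ : ∃ PF : ℝ → (GaugeConfig 3 L (Matrix.specialUnitaryGroup (Fin 2) ℂ)) → ℝ, PF = fun τ x => (∫ y, q (coords y) ∂(κ (τ : ℝ).toNNReal x)) := ⟨_, rfl⟩
  obtain ⟨PG, hPG⟩ : ∃ PG : ℝ → (GaugeConfig 3 L (Matrix.specialUnitaryGroup (Fin 2) ℂ)) → ℝ, PG = fun τ x => (∫ y, gen q y ∂(κ (τ : ℝ).toNNReal x)) := ⟨_, rfl⟩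
  obtain ⟨PH, hPH⟩ : ∃ PH : ℝ → (GaugeConfig 3 L (Matrix.specialUnitaryGroup (Fin 2) ℂ)) → ℝ, PH = fun τ x => (∫ y, gen G y ∂(κ (τ : ℝ).toNNReal x)) := ⟨_, rfl⟩
  have hPFδ : ∀ τ x, δ ≤ PF τ x := fun τ x => by rw [hPF]; exact le_transition_of_le L κ hQc hQδ _ x
  have hPFpos : ∀ τ x, 0 < PF τ x := fun τ x => hδ.trans_le (hPFδ τ x)
  have hPFcx' : ∀ τ, Continuous fun x => PF τ x := fun τ => by rw [hPF]; exact hPFcx τ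
  have hPGcx' : ∀ τ, Continuous fun x => PG τ x := fun τ => by rw [hPG]; exact hPGcx τ
  have hPHcx' : ∀ τ, Continuous fun x => PH τ x := fun τ => by rw [hPH]; exact hPHcx τ
  have hlogcx : ∀ τ, Continuous fun x => Real.log (PF τ x) := fun τ => (hPFcx' τ).log fun x => (hPFpos τ x).ne'
  set m : ℝ := ∫ x, q (coords x) ∂μ with hm
  -- the entropy `H`, and `J = −I`
  obtain ⟨H, hH⟩ : ∃ H : ℝ → ℝ, H = fun τ => ∫ x, PF τ x * Real.log (PF τ x) ∂μ := ⟨_, rfl⟩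
  obtain ⟨J, hJ⟩ : ∃ J : ℝ → ℝ, J = fun τ => ∫ x, PG τ x * Real.log (PF τ x) ∂μ := ⟨_, rfl⟩
  obtain ⟨J', hJ'⟩ : ∃ J' : ℝ → ℝ, J' = fun τ => ∫ x, (PH τ x * Real.log (PF τ x) + PG τ x ^ 2 / PF τ x) ∂μ := ⟨_, rfl⟩
  have hHpack := entropy_transition_hasDerivAt L β' κ hreal hq3 hqc hpos
  have hJpack := fisher_transition_hasDerivAt L β' κ hreal hq3 hqc hG hGc hpos hGq
  have hHc : Continuous H := by rw [hH, hPF]; exact hHpack.1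
  have hHd : ∀ τ, 0 < τ → HasDerivAt H (J τ) τ := fun τ hτ => by rw [hH, hJ, hPF, hPG]; exact hHpack.2 τ hτ
  have hJc : Continuous J := by rw [hJ, hPF, hPG]; exact hJpack.1
  have hJd : ∀ τ, 0 < τ → HasDerivAt J (J' τ) τ := fun τ hτ => by rw [hJ, hJ', hPF, hPG, hPH]; exact hJpack.2 τ hτ
  -- dissipation: `−J' ≤ c₀ J`
  have hdiss : ∀ τ : ℝ, 0 < τ → -J' τ ≤ c₀ * J τ := by
    intro τ hτ
    have h : -(∫ x, PH τ x * Real.log (PF τ x) ∂μ) - ∫ x, PG τ x ^ 2 / PF τ x ∂μ ≤ c₀ * ∫ x, PG τ x * Real.log (PF τ x) ∂μ := by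
      rw [hPF, hPG, hPH]
      exact fisher_dissipation_of_entropicCurvature L β' c₀ hECD κ hreal hq3 hqc hG hGc (τ.toNNReal) hpos hGq
    have hi1 : Integrable (fun x => PH τ x * Real.log (PF τ x)) μ :=
      integrable_of_continuous_of_compactSpace ((hPHcx' τ).mul (hlogcx τ)) _
    have hi2 : Integrable (fun x => PG τ x ^ 2 / PF τ x) μ := by
      have hc : Continuous fun x => PG τ x ^ 2 / PF τ x := by
        simp_rw [div_eq_mul_inv]
        exact ((hPGcx' τ).pow 2).mul ((hPFcx' τ).inv₀ fun x => (hPFpos τ x).ne')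
      exact integrable_of_continuous_of_compactSpace hc _
    have hsplit : J' τ = ∫ x, PH τ x * Real.log (PF τ x) ∂μ + ∫ x, PG τ x ^ 2 / PF τ x ∂μ := by
      rw [hJ']
      exact integral_add hi1 hi2
    have hJτ : J τ = ∫ x, PG τ x * Real.log (PF τ x) ∂μ := by rw [hJ]
    rw [hsplit, hJτ]
    linarith [h]
  -- `M(τ) = H(τ) + J(τ)/c₀` is non-decreasing on `[0, ∞)`
  have hmono : MonotoneOn (fun τ => H τ + J τ / c₀) (Ici 0) := by
    have hMc : ContinuousOn (fun τ => H τ + J τ / c₀) (Ici 0) := (hHc.add (hJc.div_const _)).continuousOn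
    have hMd : ∀ τ, 0 < τ → HasDerivAt (fun τ => H τ + J τ / c₀) (J τ + J' τ / c₀) τ :=
      fun τ hτ => (hHd τ hτ).add ((hJd τ hτ).div_const c₀)
    refine monotoneOn_of_deriv_nonneg (convex_Ici 0) hMc (fun τ hτ => ?_) (fun τ hτ => ?_)
    · rw [interior_Ici] at hτ
      exact (hMd τ hτ).differentiableAt.differentiableWithinAt
    · rw [interior_Ici] at hτ
      have hτ' : 0 < τ := hτ
      rw [(hMd τ hτ').deriv]
      have h1 := hdiss τ hτ'
      have h2 : J' τ / c₀ ≥ -J τ := by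
        rw [ge_iff_le, le_div_iff₀ hc₀]
        linarith
      linarith
  -- limits: `H(T) → m log m`, `J(T) → 0`
  have hHlim : Tendsto H atTop (𝓝 (m * Real.log m)) := by
    rw [hH, hPF]; exact tendsto_entropy_transition_atTop L β' κ hreal hq3 hqc hpos
  have hJlim : Tendsto J atTop (𝓝 0) := by
    rw [hJ, hPF, hPG]; exact tendsto_fisher_transition_atTop L β' κ hreal hq3 hqc hpos
  have hMlim : Tendsto (fun τ => H τ + J τ / c₀) atTop (𝓝 (m * Real.log m)) := by
    have h := hHlim.add (hJlim.div_const c₀)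
    simpa using h
  -- hence `H(τ) − m log m ≤ −J(τ)/c₀` for `τ ≥ 0`
  have hHle : ∀ τ : ℝ, 0 ≤ τ → H τ + J τ / c₀ ≤ m * Real.log m := by
    intro τ hτ
    refine ge_of_tendsto hMlim ?_
    filter_upwards [eventually_ge_atTop τ] with T hT
    exact hmono (show τ ∈ Ici (0 : ℝ) from hτ) (show T ∈ Ici (0 : ℝ) from hτ.trans hT) hT
  -- Grönwall for `E(τ) = H(τ) − m log m`: `E' = J ≤ −c₀ E`
  have hE' := le_exp_mul_of_hasDerivAt_le (w := fun τ => H τ - m * Real.log m) (w' := J) (c := c₀)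
    ((hHc.sub continuous_const).continuousOn) (fun τ hτ => (hHd τ hτ).sub_const _)
    (fun τ hτ => by
      have h3 : J τ / c₀ ≤ m * Real.log m - H τ := by linarith [hHle τ hτ.le]
      have h4 : J τ ≤ (m * Real.log m - H τ) * c₀ := (div_le_iff₀ hc₀).1 h3
      show J τ ≤ -c₀ * (H τ - m * Real.log m)
      linarith) t.coe_nonneg
  have hE : H t - m * Real.log m ≤ Real.exp (-c₀ * t) * (H 0 - m * Real.log m) := hE'
  -- read the conclusion
  have hH0 : H 0 = ∫ x, q (coords x) * Real.log (q (coords x)) ∂μ := by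
    have hκ0 : κ (0 : ℝ).toNNReal = Kernel.id := by
      rw [Real.toNNReal_zero]; exact transitionKernel_zero_eq_id (L := L) (β' := β') κ hreal
    rw [hH, hPF]
    refine integral_congr_ae (ae_of_all _ fun x => ?_)
    beta_reduce
    rw [hκ0, Kernel.id_apply, integral_dirac' _ _ hQc.measurable.stronglyMeasurable]
  have hHt : H t = ∫ x, (∫ y, q (coords y) ∂(κ t x)) * Real.log (∫ y, q (coords y) ∂(κ t x)) ∂μ := by
    rw [hH, hPF]; simp only [Real.toNNReal_coe]
  have hmt : ∫ x, (∫ y, q (coords y) ∂(κ t x)) ∂μ = m := by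
    have h := hinv t
    simp only [Real.toNNReal_coe] at h
    exact h
  rw [hmt, ← hHt, ← hH0]
  exact hE

end Summit.QuantumFields.YangMills.Theorems.ColdStartUniversality
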